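import Mathlib
import Literature.Computability.Complexity.CliqueTestGraphs
import Summits.PneNP.PneNP.Theorems.ConvexRankGatesConvexGateBlindExponentDown
import Summits.PneNP.PneNP.Theorems.ConvexRankGatesConvexGateBlindMatchingHost

/-!
# Crux `ConvexGateBlind` (stmt-PneNP-10680), line `strict-rank-conic-cover`: Rothvoss's matrix inside `D − J`

Second half of the matching minor (`ConvexRankGatesConvexGateBlindMatchingHost`: host graph, rows `mRow`, columns
`cVec`, `cliqueFn_cVec`, `cdist_mRow_cVec`). Here: perfect matchings `M` of `K_{2h}` (Mathlib
`SimpleGraph.Subgraph.IsPerfectMatching`) as rows — `pmEdges M` is a set of `h` pairwise non-touching edges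
(`card_pmEdges`, `pmEdges_pairwise`), the cut count `|M ∩ δ(U)|` in the literal `Set.ncard` shape of
`Literature.Computability.Complexity.rothvoss_matching_slack_bound` (`ncard_cut_eq`) — and the two transfer theorems:
`matchingSlack_of_coneFactorisable` (a `(PSD_0 × ℝ^r_{≥0})`-factorisation of `D − J` at `(C(2h,2)+1, h+1)` restricts to
a non-negative rank-`r` factorisation of the odd-cut slack matrix `|M ∩ δ(U)| − 1`) and, through the line's apex
padding `coneFactorisable_pad`, `matchingSlack_of_coneFactorisable_pad` (registered helper stub; any `(m, h+1+p)` with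
`C(2h,2) + 1 + p ≤ m`). [folklore]
-/

namespace Summit.PneNP.PneNP.Cruxes.ConvexGateBlind.StrictRankConicCover

open Matrix Finset Filter Literature.Computability.Complexity

noncomputable section

section matching

variable {n : ℕ}

/-! ### Perfect matchings of `K_n` as rows -/

open Classical in
/-- The edges of a subgraph `M` of `K_n`, as a finset of edges of `K_n`. [folklore] -/
def pmEdges (M : (⊤ : SimpleGraph (Fin n)).Subgraph) : Finset (Edge n) :=
  univ.filter fun e : Edge n => (e : Sym2 (Fin n)) ∈ M.edgeSet

/-- Membership in `pmEdges`. [folklore] -/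
theorem mem_pmEdges {M : (⊤ : SimpleGraph (Fin n)).Subgraph} {e : Edge n} :
    e ∈ pmEdges M ↔ (e : Sym2 (Fin n)) ∈ M.edgeSet := by
  classical
  simp [pmEdges]

/-- Distinct edges of a matching do not touch. [folklore] -/
theorem pmEdges_pairwise {M : (⊤ : SimpleGraph (Fin n)).Subgraph} (hM : M.IsMatching) :
    ∀ e ∈ pmEdges M, ∀ e' ∈ pmEdges M, e ≠ e' → ¬ Touch e e' := by
  intro e he e' he' hne ⟨v, hv, hv'⟩
  obtain ⟨w, hw⟩ := Sym2.mem_iff_exists.1 hv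
  obtain ⟨w', hw'⟩ := Sym2.mem_iff_exists.1 hv'
  rw [mem_pmEdges] at he he'
  rw [hw] at he
  rw [hw'] at he'
  have hadj : M.Adj v w := M.mem_edgeSet.1 he
  have hadj' : M.Adj v w' := M.mem_edgeSet.1 he'
  obtain ⟨z, -, hz⟩ := hM (M.edge_vert hadj)
  have hww' : w = w' := (hz w hadj).trans (hz w' hadj').symm
  apply hne
  apply Subtype.ext
  rw [hw, hw', hww']

open Classical in
/-- Every vertex lies on exactly one edge of a perfect matching. [folklore] -/
theorem card_filter_mem_pmEdges {M : (⊤ : SimpleGraph (Fin n)).Subgraph} (hM : M.IsPerfectMatching) (v : Fin n) :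
    ((pmEdges M).filter fun e : Edge n => v ∈ (e : Sym2 (Fin n))).card = 1 := by
  obtain ⟨w, hvw, -⟩ := SimpleGraph.Subgraph.isPerfectMatching_iff.1 hM v
  have hne : v ≠ w := (M.adj_sub hvw).ne
  have hmem : s(v, w) ∈ (⊤ : SimpleGraph (Fin n)).edgeSet := by simpa using hne
  rw [Finset.card_eq_one]
  refine ⟨⟨s(v, w), hmem⟩, ?_⟩
  ext e
  simp only [Finset.mem_filter, Finset.mem_singleton]
  constructor
  · rintro ⟨he, hve⟩
    have he1 : (⟨s(v, w), hmem⟩ : Edge n) ∈ pmEdges M := mem_pmEdges.2 (M.mem_edgeSet.2 hvw)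
    by_contra hne'
    exact pmEdges_pairwise hM.1 e he _ he1 hne' ⟨v, hve, Sym2.mem_mk_left v w⟩
  · rintro rfl
    exact ⟨mem_pmEdges.2 (M.mem_edgeSet.2 hvw), Sym2.mem_mk_left v w⟩

/-- A perfect matching of `K_{2h}` has `h` edges. [folklore] -/
theorem card_pmEdges {M : (⊤ : SimpleGraph (Fin n)).Subgraph} (hM : M.IsPerfectMatching) {h : ℕ}
    (hn : n = 2 * h) : (pmEdges M).card = h := by
  classical
  -- double count the incidences (vertex, edge of `M` through it)
  have hcount : n = 2 * (pmEdges M).card :=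
    calc n = ∑ _v : Fin n, (1 : ℕ) := by simp
      _ = ∑ v : Fin n, ∑ e ∈ pmEdges M, (if v ∈ (e : Sym2 (Fin n)) then 1 else 0 : ℕ) :=
          Finset.sum_congr rfl fun v _ => by rw [← Finset.card_filter, card_filter_mem_pmEdges hM v]
      _ = ∑ e ∈ pmEdges M, ∑ v : Fin n, (if v ∈ (e : Sym2 (Fin n)) then 1 else 0 : ℕ) := Finset.sum_comm
      _ = ∑ _e ∈ pmEdges M, (2 : ℕ) :=
          Finset.sum_congr rfl fun e _ => by rw [← Finset.card_filter, ← card_ends e]; rfl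
      _ = 2 * (pmEdges M).card := by rw [Finset.sum_const, smul_eq_mul, mul_comm]
  omega

open Classical in
/-- The cut count of the slack matrix, as the cardinality of a finset of edges of `K_n`. [folklore] -/
theorem ncard_cut_eq {M : (⊤ : SimpleGraph (Fin n)).Subgraph} (U : Finset (Fin n)) :
    (M.edgeSet ∩ {e | ∃ x ∈ U, ∃ y ∉ U, e = s(x, y)}).ncard =
      ((pmEdges M).filter fun e : Edge n => InCut U (e : Sym2 (Fin n))).card := by
  rw [← Finset.card_map (Function.Embedding.subtype _), ← Set.ncard_coe_finset]
  congr 1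
  ext e
  simp only [Set.mem_inter_iff, Set.mem_setOf_eq, Finset.coe_map, Function.Embedding.coe_subtype,
    Set.mem_image, Finset.mem_coe, Finset.mem_filter, mem_pmEdges, InCut]
  constructor
  · rintro ⟨he, hcut⟩
    exact ⟨⟨e, M.edgeSet_subset he⟩, ⟨he, hcut⟩, rfl⟩
  · rintro ⟨e', ⟨he', hcut⟩, rfl⟩
    exact ⟨he', hcut⟩

/-- **Restriction to the matching slack.** A `(PSD_0 × ℝ^r_{≥0})`-factorisation of `D − J` at
`(m, k) = (C(2h,2) + 1, h + 1)` restricts, along rows `row(M)` (perfect matchings `M` of `K_{2h}`) and columns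
`col(U)` (`#U` odd), to a non-negative factorisation with `r` terms of Rothvoss's odd-cut slack matrix
`|M ∩ δ(U)| − 1`. [folklore] -/
theorem matchingSlack_of_coneFactorisable {h r : ℕ}
    (hf : ConeFactorisable (NE (2 * h) + 1) (h + 1) 0 r (fun _ => 1) (fun _ => 1)) :
    ∃ (a : Finset (Fin (2 * h)) → Fin r → ℝ) (b : (⊤ : SimpleGraph (Fin (2 * h))).Subgraph → Fin r → ℝ),
      (∀ U i, 0 ≤ a U i) ∧ (∀ M i, 0 ≤ b M i) ∧
        ∀ (U : Finset (Fin (2 * h))) (M : (⊤ : SimpleGraph (Fin (2 * h))).Subgraph),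
          Odd U.card → M.IsPerfectMatching →
            ((M.edgeSet ∩ {e | ∃ x ∈ U, ∃ y ∉ U, e = s(x, y)}).ncard : ℝ) - 1 = ∑ i, a U i * b M i := by
  classical
  obtain ⟨H, Y, Uc, Vc, -, -, hU, hV, hfact⟩ := hf
  refine ⟨fun U i => Uc (cVec U) i, fun M i => Vc i (mRow (pmEdges M)), fun U i => hU _ _, fun M i => hV _ _,
    fun U M hUodd hM => ?_⟩
  have hrow : (mRow (pmEdges M)).card = h + 1 := by rw [card_mRow, card_pmEdges hM rfl]
  have hid := hfact (mRow (pmEdges M)) (cVec U) hrow (cliqueFn_cVec hUodd rfl)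
  rw [cdist_mRow_cVec (pmEdges_pairwise hM.1) U] at hid
  have htr : (H (cVec U) * Y (mRow (pmEdges M))).trace = 0 := by simp [Matrix.trace]
  rw [htr, zero_add, mul_one] at hid
  rw [ncard_cut_eq U]
  convert hid using 2

/-! ### Apex padding: every `(m, h + 1 + p)` with `C(2h,2) + 1 + p ≤ m` -/

/-- `NE n = C(n, 2)`. [folklore] -/
theorem NE_eq (n : ℕ) : NE n = n.choose 2 := by
  classical
  rw [NE, SimpleGraph.card_edgeSet, SimpleGraph.card_edgeFinset_top_eq_card_choose_two, Fintype.card_fin]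

/-- **Unconditional core.** If `C(2h,2) + 1 + p ≤ m` and `1 ≤ h`, a `(PSD_0 × ℝ^r_{≥0})`-factorisation of the unit-potential
matrix `D_{m, h+1+p} − J` yields a non-negative factorisation with `r` terms of the odd-cut slack matrix of the
perfect matching polytope of `K_{2h}` (apex/isolated padding `coneFactorisable_pad`, then the matching submatrix).
[folklore] -/
theorem matchingSlack_of_coneFactorisable_pad :
    ∀ {m h p r : ℕ}, 1 ≤ h → (2 * h).choose 2 + 1 + p ≤ m →
      ConeFactorisable m (h + 1 + p) 0 r (fun _ => 1) (fun _ => 1) →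
        ∃ (a : Finset (Fin (2 * h)) → Fin r → ℝ) (b : (⊤ : SimpleGraph (Fin (2 * h))).Subgraph → Fin r → ℝ),
          (∀ U i, 0 ≤ a U i) ∧ (∀ M i, 0 ≤ b M i) ∧
            ∀ (U : Finset (Fin (2 * h))) (M : (⊤ : SimpleGraph (Fin (2 * h))).Subgraph),
              Odd U.card → M.IsPerfectMatching →
                ((M.edgeSet ∩ {e | ∃ x ∈ U, ∃ y ∉ U, e = s(x, y)}).ncard : ℝ) - 1 = ∑ i, a U i * b M i := by
  intro m h p r hh hfit hf
  rw [← NE_eq] at hfit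
  exact matchingSlack_of_coneFactorisable (coneFactorisable_pad hfit (by omega : 2 ≤ h + 1) hf)

end matching

end

end Summit.PneNP.PneNP.Cruxes.ConvexGateBlind.StrictRankConicCover
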